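import Summits.MatrixMultiplication.MatrixMultiplication.Theorems.FarEdgeDescentTwistImage
import Summits.MatrixMultiplication.MatrixMultiplication.Theorems.FarEdgeDescentSignTwistComm
import Summits.MatrixMultiplication.MatrixMultiplication.Theorems.FarEdgeDescentSignTwistYDet
import Summits.MatrixMultiplication.MatrixMultiplication.Theorems.FarEdgeDescentTwistQuantumTwin
import HarnessLib

/-!
# The generic stratum at `n = 2` is a degeneration antichain of quantum twins

Route `FarEdgeDescent` (cell `decomp-mm`, lens 2 «structural dichotomy (special vs generic)»,
gen 32), Kernel VII — the assembled statement; support for the aside `SubLogRate`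
(stmt-MatrixMultiplication-25371).

Lens 2 splits the star tensors `𝔖_φ ≅_{Q} ⟨2,2,2⟩` into the SPECIAL stratum (product
relabelings, `≅ ⟨2,2,2⟩`) and the GENERIC stratum.  At `n = 2`, `N = 1` the generic stratum
met so far consists of the twisted star `𝔖^ᵀ = twistedStar K 2 1`, the sign twist
`𝔖^♭ = signStar K` (the
Cohn–Umans / Bläser–Christandl–Zuiddam weight twist `⟨2,2,2⟩_{-1}`) and its transpose
`𝔖^♭ᵀ = signTStar K`.  This file assembles the kernels of gens 28–32 into one statement:

* `generic_stratum_antichain` — over an infinite field of characteristic `≠ 2` the four classes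
  `⟨2,2,2⟩, 𝔖^ᵀ, 𝔖^♭, 𝔖^♭ᵀ` are PAIRWISE DEGENERATION-INCOMPARABLE (all twelve ordered
  pairs),
  by six different obstructions: rigidity of the coherent configuration (`⟨2,2,2⟩ ⋭ ·`,
  `FarEdgeDescentTwistRigidity`, `FarEdgeDescentSignTwist`), the image class of the pencil
  (`𝔖^ᵀ ⋭ ⟨2,2,2⟩`, `…TwistImage`), the `x`-pencil determinant class
  (`𝔖^♭, 𝔖^♭ᵀ ⋭ ⟨2,2,2⟩, 𝔖^ᵀ`, `…SignTwistDet`, `…TwistDetClass`), the full slice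
  (`𝔖^ᵀ ⋭ 𝔖^♭, 𝔖^♭ᵀ`, `…SignTwistCore`, re-proved by determinant class in
  `…TwistDetClass`), the `y`-pencil commutant (`𝔖^♭ ⋭ 𝔖^♭ᵀ`, `…SignTwistComm`) and the
  `y`-pencil determinant class (`𝔖^♭ᵀ ⋭ 𝔖^♭`, `…SignTwistYDet`);
* `complex_generic_stratum` — over `ℂ` all four have the SAME quantum functionals
  (`FarEdgeDescentTwistQuantumTwin`): the special/generic dichotomy and the antichain are
  invisible to every spectral point;
* `charTwo_collapse` — in characteristic `2` the sign twists ARE the special/twisted pair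
  (`𝔖^♭ = 𝔖_{id}`, `𝔖^♭ᵀ = 𝔖^ᵀ`), so the hypothesis `2 ≠ 0` in the determinant-class
  kernels is exactly the locus where the four classes are distinct; `𝔖^♭ᵀ ⋭ 𝔖^♭`
  nevertheless holds over every infinite field (`signTStar_not_algDegeneratesTo_signStar'`).

References: P. Bürgisser, M. Clausen, M. A. Shokrollahi, *Algebraic Complexity Theory* (1997),
(15.19), §20.2 [BurgisserClausenShokrollahi1997]; H. Cohn, C. Umans, SODA 2013, §3
[CohnUmans2013]; M. Bläser, M. Christandl, J. Zuiddam, arXiv:1705.09652, Thm. 1–2, Def. 5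
[BlaserChristandlZuiddam2017]; V. Strassen, J. reine angew. Math. 384 (1988) [Strassen1988].
-/

noncomputable section

open scoped BigOperators

set_option linter.dupNamespace false

namespace Summit.MatrixMultiplication.MatrixMultiplication.Theorems.FarEdgeDescentGenericAntichain

open Literature.Computability.AlgebraicComplexity
open Summit.MatrixMultiplication.MatrixMultiplication.Theorems.FarEdgeDescentSignTwist
open Summit.MatrixMultiplication.MatrixMultiplication.Theorems.FarEdgeDescentSignTwistDet
open Summit.MatrixMultiplication.MatrixMultiplication.Theorems.FarEdgeDescentSignTwistComm
open Summit.MatrixMultiplication.MatrixMultiplication.Theorems.FarEdgeDescentSignTwistYDet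
open Summit.MatrixMultiplication.MatrixMultiplication.Theorems.FarEdgeDescentTwistImage
open Summit.MatrixMultiplication.MatrixMultiplication.Theorems.FarEdgeDescentTwistedStar
open Summit.MatrixMultiplication.MatrixMultiplication.Theorems.FarEdgeDescentTwistRigidity
open Summit.MatrixMultiplication.MatrixMultiplication.Theorems.FarEdgeDescentTwistQuantumTwin
open Summit.MatrixMultiplication.MatrixMultiplication.Theorems.FarEdgeDescentQuantumTwin

universe u

section AnyField
variable (K : Type u) [Field K]

/-- **The generic stratum at `n = 2`, `N = 1` is a degeneration antichain** (infinite field,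
characteristic `≠ 2`): all twelve ordered pairs among `⟨2,2,2⟩, 𝔖^ᵀ, 𝔖^♭, 𝔖^♭ᵀ` are
non-degenerations. [cite: BurgisserClausenShokrollahi1997, (15.19), sec. 20.2] -/
theorem generic_stratum_antichain [Infinite K] (h2 : (2 : K) ≠ 0) :
    (¬ AlgDegeneratesTo (matMulTensor K 2 2 (1 + 1)) (twistedStar K 2 1) ∧
      ¬ AlgDegeneratesTo (twistedStar K 2 1) (matMulTensor K 2 2 (1 + 1))) ∧
    (¬ AlgDegeneratesTo (matMulTensor K 2 2 (1 + 1)) (signStar K) ∧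
      ¬ AlgDegeneratesTo (signStar K) (matMulTensor K 2 2 (1 + 1))) ∧
    (¬ AlgDegeneratesTo (matMulTensor K 2 2 (1 + 1)) (signTStar K) ∧
      ¬ AlgDegeneratesTo (signTStar K) (matMulTensor K 2 2 (1 + 1))) ∧
    (¬ AlgDegeneratesTo (twistedStar K 2 1) (signStar K) ∧
      ¬ AlgDegeneratesTo (signStar K) (twistedStar K 2 1)) ∧
    (¬ AlgDegeneratesTo (twistedStar K 2 1) (signTStar K) ∧
      ¬ AlgDegeneratesTo (signTStar K) (twistedStar K 2 1)) ∧
    (¬ AlgDegeneratesTo (signStar K) (signTStar K) ∧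
      ¬ AlgDegeneratesTo (signTStar K) (signStar K)) := by
  obtain ⟨hTM, hMT⟩ := twistedStar_matMul_degeneration_incomparable K
  obtain ⟨⟨hFM, hMF⟩, ⟨hGM, hMG⟩⟩ := sign_classes_degeneration_incomparable K h2
  obtain ⟨⟨hFT, hTF⟩, ⟨hGT, hTG⟩⟩ := generic_twists_detClass_incomparable K h2
  exact ⟨⟨hMT, hTM⟩, ⟨hMF, hFM⟩, ⟨hMG, hGM⟩, ⟨hTF, hFT⟩, ⟨hTG, hGT⟩,
    ⟨signStar_not_algDegeneratesTo_signTStar K, signTStar_not_algDegeneratesTo_signStar K h2⟩⟩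

/-! ## Characteristic `2`: the sign twists collapse onto the special/twisted pair -/

/-- In characteristic `2` the sign weight is trivial. [folklore] -/
theorem sgnWeight_of_charTwo (h : (2 : K) = 0) : sgnWeight K = fun _ => 1 := by
  funext b
  have h1 : (-1 : K) = 1 := by linear_combination -h
  by_cases hb : b = (1, 0) <;> simp [sgnWeight, hb, h1]

/-- In characteristic `2`, `𝔖^♭ = 𝔖_{id}` (the special, coherent star). [folklore] -/
theorem signStar_of_charTwo (h : (2 : K) = 0) :
    signStar K = permStar K 2 1 (Equiv.refl _) := by
  change weightedStar K 2 1 (sgnWeight K) = _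
  rw [sgnWeight_of_charTwo K h, weightedStar_one]

/-- In characteristic `2`, `𝔖^♭ᵀ = 𝔖^ᵀ` (the twisted star). [folklore] -/
theorem signTStar_of_charTwo (h : (2 : K) = 0) : signTStar K = twistedStar K 2 1 := by
  change weightedTStar K 2 1 (sgnWeight K) = _
  rw [sgnWeight_of_charTwo K h, weightedTStar_one]

/-- **`𝔖^♭ᵀ ⋭ 𝔖^♭` in characteristic `2`** (infinite field): there it reads
`𝔖^ᵀ ⋭ 𝔖_{id} ≥ ⟨2,2,2⟩`, which is the image-class kernel.
[cite: BurgisserClausenShokrollahi1997, (15.19), sec. 20.2] -/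
theorem signTStar_not_algDegeneratesTo_signStar_of_charTwo [Infinite K] (h : (2 : K) = 0) :
    ¬ AlgDegeneratesTo (signTStar K) (signStar K) := by
  rw [signStar_of_charTwo K h, signTStar_of_charTwo K h]
  exact fun hd => twistedStar_not_algDegeneratesTo_matMul K
    (hd.trans_restrictsTo (permStar_restrictsTo_matMul IsProdPerm.refl))

/-- **`𝔖^♭ᵀ ⋭ 𝔖^♭` over every infinite field** (determinant class of the `y`-pencil in
characteristic `≠ 2`, image class in characteristic `2`); the converse `𝔖^♭ ⋭ 𝔖^♭ᵀ` holds
over every field (`signStar_not_algDegeneratesTo_signTStar`).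
[cite: BurgisserClausenShokrollahi1997, (15.19), sec. 20.2] -/
theorem signTStar_not_algDegeneratesTo_signStar' [Infinite K] :
    ¬ AlgDegeneratesTo (signTStar K) (signStar K) := by
  by_cases h : (2 : K) = 0
  · exact signTStar_not_algDegeneratesTo_signStar_of_charTwo K h
  · exact signTStar_not_algDegeneratesTo_signStar K h

/-- **Characteristic-`2` collapse.** The sign twists become the special star `𝔖_{id}` and the
twisted star `𝔖^ᵀ`; the two remaining classes are still degeneration-incomparable (infinite
field). [cite: BurgisserClausenShokrollahi1997, (15.19), sec. 20.2] -/
theorem charTwo_collapse [Infinite K] (h : (2 : K) = 0) :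
    signStar K = permStar K 2 1 (Equiv.refl _) ∧ signTStar K = twistedStar K 2 1 ∧
    ¬ AlgDegeneratesTo (signStar K) (signTStar K) ∧
    ¬ AlgDegeneratesTo (signTStar K) (signStar K) :=
  ⟨signStar_of_charTwo K h, signTStar_of_charTwo K h, signStar_not_algDegeneratesTo_signTStar K,
    signTStar_not_algDegeneratesTo_signStar_of_charTwo K h⟩

end AnyField

/-! ## Over `ℂ`: an antichain of quantum twins -/

/-- **Over `ℂ` the generic stratum is a degeneration antichain of quantum twins**: every quantum
functional takes the same value on `⟨2,2,2⟩, 𝔖^ᵀ, 𝔖^♭, 𝔖^♭ᵀ` (the CVZ quantum functionals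
cannot see the special/generic dichotomy), yet no two of the four are comparable under
degeneration. [cite: BlaserChristandlZuiddam2017, Thm. 1-2, Def. 5] -/
theorem complex_generic_stratum (θ : Fin 3 → ℝ) (hθ : ∀ i, 0 ≤ θ i) :
    (quantumFunctional θ (twistedStar ℂ 2 1) =
        quantumFunctional θ (matMulTensor ℂ 2 2 (1 + 1)) ∧
      quantumFunctional θ (signStar ℂ) = quantumFunctional θ (matMulTensor ℂ 2 2 (1 + 1)) ∧
      quantumFunctional θ (signTStar ℂ) =
        quantumFunctional θ (matMulTensor ℂ 2 2 (1 + 1))) ∧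
    ((¬ AlgDegeneratesTo (matMulTensor ℂ 2 2 (1 + 1)) (twistedStar ℂ 2 1) ∧
      ¬ AlgDegeneratesTo (twistedStar ℂ 2 1) (matMulTensor ℂ 2 2 (1 + 1))) ∧
    (¬ AlgDegeneratesTo (matMulTensor ℂ 2 2 (1 + 1)) (signStar ℂ) ∧
      ¬ AlgDegeneratesTo (signStar ℂ) (matMulTensor ℂ 2 2 (1 + 1))) ∧
    (¬ AlgDegeneratesTo (matMulTensor ℂ 2 2 (1 + 1)) (signTStar ℂ) ∧
      ¬ AlgDegeneratesTo (signTStar ℂ) (matMulTensor ℂ 2 2 (1 + 1))) ∧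
    (¬ AlgDegeneratesTo (twistedStar ℂ 2 1) (signStar ℂ) ∧
      ¬ AlgDegeneratesTo (signStar ℂ) (twistedStar ℂ 2 1)) ∧
    (¬ AlgDegeneratesTo (twistedStar ℂ 2 1) (signTStar ℂ) ∧
      ¬ AlgDegeneratesTo (signTStar ℂ) (twistedStar ℂ 2 1)) ∧
    (¬ AlgDegeneratesTo (signStar ℂ) (signTStar ℂ) ∧
      ¬ AlgDegeneratesTo (signTStar ℂ) (signStar ℂ))) := by
  obtain ⟨hF, hG, hT, -, -⟩ := sign_classes_quantum_twins 1 le_rfl θ hθ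
  exact ⟨⟨hT, hF, hG⟩, generic_stratum_antichain ℂ two_ne_zero⟩

end Summit.MatrixMultiplication.MatrixMultiplication.Theorems.FarEdgeDescentGenericAntichain

end
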